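import Mathlib
import HarnessLib
import Summits.ValiantsHypothesis.ValiantsHypothesis.Theorems.LacunarySymmetroidMatrixDescartesProductPlusOneRateWindowCellEveryK
import Summits.ValiantsHypothesis.ValiantsHypothesis.Theorems.LacunarySymmetroidMatrixDescartesProductPlusOneRowTowerKPairLaw

/-!
# LINE (A) `product_plus_one` — the TWO-CLUSTER CELL for every K (pair-gap law, both sides of the root)

Support `d : Fin (n+2) → ℕ` (`StrictMono d`), rows `f_j = Σ_l C (a j l) X^{d l}`, window `(u,v)` (`0 < u`), threshold `p : ℕ`, `0 < p`.  THE MENU (per row):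
* a TWO-CLUSTER row: a cut `k` with all coefficients of one sign at letters `≤ k` and of the other sign at letters `> k`, at least two active letters,
  every two active letters on the same side of the cut at gap `≤ p`, every two on opposite sides at gap `≥ p`, and `f_j ≠ 0` on `(u,v)` (coherent rows,
  binomial poles, «knee window + pole cluster», switched clouds of tail span `≤ p` … ON EITHER SIDE OF THE ROOT) — law by ✓ `rowPsiK3_pairGap_law`;
* or a CLOUD left of its root with active tail rates `≥ p` (✓ `rowLawsAt_cloud`).
THEN ★★ `twoClusterCellEveryK_wronskian_roots_le_two`: `W(∏_j f_j)` has AT MOST TWO roots in `(u,v)`; ★★ `twoClusterCellEveryK_eulerNumerator_roots_le_three`: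
every `eulerNumerator d a l₀` (unfolded) has AT MOST THREE.  For `K = 3`, `p = d₁ − d₀` the new free rows are `(+,+,−)` with `d₂ − d₁ ≥ d₁ − d₀` and
`(−,+,+)` / switched `(+,−,−)` with `d₂ − d₁ ≤ d₁ − d₀`, on both sides of their root.

Honest framing: ONE W-cell family (helper; every K); nothing closes a stub; the fast-knee cell (#19), `WronskianBudgetK3`, `OneChangeFloorK3`, `stub_classRowK3`,
`stub_polyLaw`, 18050 `MatrixDescartes`, Conjecture B are NOT proved; `VP ≠ VNP` NOT proved.  No definitions, no named facts.
-/

set_option linter.dupNamespace false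

namespace Summit.ValiantsHypothesis.ValiantsHypothesis.Theorems.LacunarySymmetroidMatrixDescartes

namespace ProductPlusOne

open Finset Set Polynomial
open scoped BigOperators Topology Polynomial

/-- ★ **ROW LAW, two-cluster row** (sign pattern: `≥ 0` up to the cut `k`, `≤ 0` above it; at least two active letters; same-side active pairs at gap `≤ p`,
cross pairs at gap `≥ p`; `x > 0` with `f(x) ≠ 0`): the stripped row is non-zero and `p²ψ₁ < ψ₃`. [this file's theorem] -/
theorem rowLawsAt_twoCluster_pos {n : ℕ} (d : Fin (n + 2) → ℕ) (hd : StrictMono d) (b : Fin (n + 2) → ℝ) (p : ℕ) (k : Fin (n + 2))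
    (hlow : ∀ l, l ≤ k → 0 ≤ b l) (hhigh : ∀ l, k < l → b l ≤ 0)
    (hact : ∃ l l', l ≠ l' ∧ b l ≠ 0 ∧ b l' ≠ 0)
    (hwidth : ∀ l l', b l ≠ 0 → b l' ≠ 0 → (l' ≤ k ∨ k < l) → d l' ≤ d l + p)
    (hsep : ∀ l l', b l ≠ 0 → b l' ≠ 0 → l ≤ k → k < l' → d l + p ≤ d l')
    {x : ℝ} (hx0 : 0 < x) (hfx : (∑ l, C (b l) * X ^ (d l) : ℝ[X]).eval x ≠ 0) :
    b 0 - ∑ l : Fin (n + 1), (-(b l.succ)) * x ^ (d l.succ - d 0) ≠ 0 ∧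
    (p : ℝ) ^ 2 * rowPsiK1 (fun l : Fin (n + 1) => d l.succ - d 0) (b 0) (fun l : Fin (n + 1) => -(b l.succ)) x
      < rowPsiK3 (fun l : Fin (n + 1) => d l.succ - d 0) (b 0) (fun l : Fin (n + 1) => -(b l.succ)) x := by
  have hd0 : ∀ l, d 0 ≤ d l := fun l => hd.monotone (Fin.zero_le l)
  set lam : Fin (n + 1) → ℕ := fun l => d l.succ - d 0 with hlam
  set B : Fin (n + 1) → ℝ := fun l => -(b l.succ) with hBdef
  have hF : b 0 - ∑ l : Fin (n + 1), B l * x ^ (lam l) ≠ 0 := by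
    intro h
    apply hfx
    rw [eval_rowK_eq d hd0 b x]
    simp only [hBdef, hlam] at h ⊢
    rw [h, mul_zero]
  refine ⟨hF, ?_⟩
  -- same sign ⇒ same side of the cut
  have hside : ∀ l l', 0 < b l * b l' → (l ≤ k ∧ l' ≤ k) ∨ (k < l ∧ k < l') := by
    intro l l' hll'
    rcases le_or_gt l k with h1 | h1 <;> rcases le_or_gt l' k with h2 | h2
    · exact Or.inl ⟨h1, h2⟩
    · exact absurd hll' (not_lt.2 (mul_nonpos_of_nonneg_of_nonpos (hlow l h1) (hhigh l' h2)))
    · exact absurd hll' (not_lt.2 (mul_nonpos_of_nonpos_of_nonneg (hhigh l h1) (hlow l' h2)))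
    · exact Or.inr ⟨h1, h2⟩
  have hcross : ∀ l l', b l * b l' < 0 → (l ≤ k ∧ k < l') ∨ (l' ≤ k ∧ k < l) := by
    intro l l' hll'
    rcases le_or_gt l k with h1 | h1 <;> rcases le_or_gt l' k with h2 | h2
    · exact absurd hll' (not_lt.2 (mul_nonneg (hlow l h1) (hlow l' h2)))
    · exact Or.inl ⟨h1, h2⟩
    · exact Or.inr ⟨h2, h1⟩
    · exact absurd hll' (not_lt.2 (mul_nonneg_of_nonpos_of_nonpos (hhigh l h1) (hhigh l' h2)))
  have hne_of_mul : ∀ {s t : ℝ}, s * t ≠ 0 → s ≠ 0 ∧ t ≠ 0 := fun h => ⟨left_ne_zero_of_mul h, right_ne_zero_of_mul h⟩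
  -- the four pair-gap hypotheses of the tower
  have hsame : ∀ l l', 0 < B l * B l' → lam l ≤ lam l' + p ∧ lam l' ≤ lam l + p := by
    intro l l' hBB
    have hbb : 0 < b l.succ * b l'.succ := by simp only [hBdef] at hBB; linarith
    obtain ⟨h1, h2⟩ := hne_of_mul hbb.ne'
    have hw1 : d l'.succ ≤ d l.succ + p := by
      rcases hside _ _ hbb with ⟨ha, hb⟩ | ⟨ha, hb⟩
      · exact hwidth _ _ h1 h2 (Or.inl hb)
      · exact hwidth _ _ h1 h2 (Or.inr ha)
    have hw2 : d l.succ ≤ d l'.succ + p := by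
      rcases hside _ _ hbb with ⟨ha, hb⟩ | ⟨ha, hb⟩
      · exact hwidth _ _ h2 h1 (Or.inl ha)
      · exact hwidth _ _ h2 h1 (Or.inr hb)
    have := hd0 l.succ; have := hd0 l'.succ
    constructor <;> simp only [hlam] <;> omega
  have hopp : ∀ l l', B l * B l' < 0 → lam l + p ≤ lam l' ∨ lam l' + p ≤ lam l := by
    intro l l' hBB
    have hbb : b l.succ * b l'.succ < 0 := by simp only [hBdef] at hBB; linarith
    obtain ⟨h1, h2⟩ := hne_of_mul hbb.ne
    have := hd0 l.succ; have := hd0 l'.succ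
    rcases hcross _ _ hbb with ⟨ha, hb⟩ | ⟨ha, hb⟩
    · have := hsep _ _ h1 h2 ha hb
      left; simp only [hlam]; omega
    · have := hsep _ _ h2 h1 ha hb
      right; simp only [hlam]; omega
  have hk0 : (0 : Fin (n + 2)) ≤ k := Fin.zero_le k
  have hsame0 : ∀ l, b 0 * B l < 0 → lam l ≤ p := by
    intro l hBB
    have hbb : 0 < b 0 * b l.succ := by simp only [hBdef] at hBB; linarith
    obtain ⟨h1, h2⟩ := hne_of_mul hbb.ne'
    rcases hside _ _ hbb with ⟨-, hb⟩ | ⟨ha, -⟩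
    · have hw := hwidth 0 l.succ h1 h2 (Or.inl hb)
      simp only [hlam]; omega
    · exact absurd ha (not_lt.2 hk0)
  have hopp0 : ∀ l, 0 < b 0 * B l → p ≤ lam l := by
    intro l hBB
    have hbb : b 0 * b l.succ < 0 := by simp only [hBdef] at hBB; linarith
    obtain ⟨h1, h2⟩ := hne_of_mul hbb.ne
    rcases hcross _ _ hbb with ⟨-, hb⟩ | ⟨-, hb⟩
    · have := hsep 0 l.succ h1 h2 hk0 hb
      have := hd0 l.succ
      simp only [hlam]; omega
    · exact absurd hb (not_lt.2 hk0)
  -- strictness: either an active pair at gap `≠ p`, or the row is a binomial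
  by_cases hpair : ∃ l l', l < l' ∧ b l ≠ 0 ∧ b l' ≠ 0 ∧ d l' - d l ≠ p
  · obtain ⟨l, l', hll', hl, hl', hgap⟩ := hpair
    have hdll' : d l < d l' := hd hll'
    refine rowPsiK3_gt_of_pairGap_of_pair lam (b 0) B p hx0 hF hsame hopp hsame0 hopp0 ?_
    -- locate the pair in the tower: is `l` the bottom letter?
    rcases Fin.eq_zero_or_eq_succ l with h0 | ⟨i, hi⟩
    · subst h0
      obtain ⟨i', hi'⟩ : ∃ i' : Fin (n + 1), l' = i'.succ := by
        rcases Fin.eq_zero_or_eq_succ l' with h | h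
        · exact absurd h (ne_of_gt hll')
        · exact h
      subst hi'
      right
      refine ⟨i', ?_⟩
      have hBi : B i' = -(b i'.succ) := rfl
      rcases lt_or_gt_of_ne (mul_ne_zero hl hl') with hneg | hpos
      · -- opposite signs: cross pair, gap `> p`
        right
        have hsep' := hsep 0 i'.succ hl hl' hk0 (by
          rcases hcross _ _ hneg with ⟨-, hb⟩ | ⟨-, hb⟩
          · exact hb
          · exact absurd hb (not_lt.2 hk0))
        refine ⟨by rw [hBi]; linarith, ?_⟩
        simp only [hlam]; omega
      · left
        have hw : d i'.succ ≤ d 0 + p := by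
          rcases hside _ _ hpos with ⟨-, hb⟩ | ⟨ha, -⟩
          · exact hwidth 0 i'.succ hl hl' (Or.inl hb)
          · exact absurd ha (not_lt.2 hk0)
        refine ⟨by rw [hBi]; linarith, ?_, ?_⟩
        · simp only [hlam]; omega
        · simp only [hlam]; omega
    · subst hi
      obtain ⟨i', hi'⟩ : ∃ i' : Fin (n + 1), l' = i'.succ := by
        rcases Fin.eq_zero_or_eq_succ l' with h | h
        · exact absurd h (ne_of_gt (lt_of_le_of_lt (Fin.zero_le _) hll'))
        · exact h
      subst hi'
      left
      refine ⟨i, i', ?_⟩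
      have hBi : B i * B i' = b i.succ * b i'.succ := by simp only [hBdef]; ring
      have := hd0 i.succ
      rcases lt_or_gt_of_ne (mul_ne_zero hl hl') with hneg | hpos
      · right
        rcases hcross _ _ hneg with ⟨ha, hb⟩ | ⟨ha, hb⟩
        · have hsep' := hsep _ _ hl hl' ha hb
          refine ⟨by rw [hBi]; exact hneg, ?_⟩
          simp only [hlam]; omega
        · exact absurd (lt_trans hb hll') (not_lt.2 ha)
      · left
        have hw : d i'.succ ≤ d i.succ + p := by
          rcases hside _ _ hpos with ⟨ha, hb⟩ | ⟨ha, hb⟩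
          · exact hwidth _ _ hl hl' (Or.inl hb)
          · exact hwidth _ _ hl hl' (Or.inr ha)
        refine ⟨by rw [hBi]; exact hpos, ?_, ?_⟩
        · simp only [hlam]; omega
        · simp only [hlam]; omega
  · -- every active pair is at gap exactly `p`: the row is a binomial, `ψ₁ ≠ 0`
    push Not at hpair
    obtain ⟨l₁, l₂, h12, hl₁, hl₂⟩ := hact
    -- order the two letters
    have key : ∀ l l', l < l' → b l ≠ 0 → b l' ≠ 0 → d l' - d l = p := fun l l' h hl hl' => hpair l l' h hl hl'
    have hgap_of_ne : ∀ l l', l ≠ l' → b l ≠ 0 → b l' ≠ 0 → (d l' = d l + p ∨ d l = d l' + p) := by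
      intro l l' hll' hl hl'
      rcases lt_or_gt_of_ne hll' with h | h
      · have := key l l' h hl hl'; have := (hd h).le; omega
      · have := key l' l h hl' hl; have := (hd h).le; omega
    have hp0 : 0 < p := by
      rcases lt_or_gt_of_ne h12 with h | h
      · have := key _ _ h hl₁ hl₂; have := hd h; omega
      · have := key _ _ h hl₂ hl₁; have := hd h; omega
    -- no third active letter
    have hthird : ∀ l, l ≠ l₁ → l ≠ l₂ → b l = 0 := by
      intro l h1 h2
      by_contra hl
      have g1 := hgap_of_ne l l₁ h1 hl hl₁
      have g2 := hgap_of_ne l l₂ h2 hl hl₂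
      have g3 := hgap_of_ne l₁ l₂ h12 hl₁ hl₂
      have hinj : d l ≠ d l₁ := fun h => h1 (hd.injective h)
      have hinj' : d l ≠ d l₂ := fun h => h2 (hd.injective h)
      omega
    refine rowPsiK3_gt_of_pairGap lam (b 0) B p hx0 hF hsame hopp hsame0 hopp0 ?_
    -- `ψ₁ ≠ 0` for the binomial on the letters `l₁, l₂`
    -- wlog `l₁ < l₂`
    have main : ∀ m₁ m₂ : Fin (n + 2), m₁ < m₂ → b m₁ ≠ 0 → b m₂ ≠ 0 → (∀ l, l ≠ m₁ → l ≠ m₂ → b l = 0) →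
        rowPsiK1 lam (b 0) B x ≠ 0 := by
      intro m₁ m₂ hm hm₁ hm₂ hzero
      obtain ⟨j, hj⟩ : ∃ j : Fin (n + 1), m₂ = j.succ := by
        rcases Fin.eq_zero_or_eq_succ m₂ with h | h
        · exact absurd h (ne_of_gt (lt_of_le_of_lt (Fin.zero_le _) hm))
        · exact h
      subst hj
      have hlamj : lam j ≠ 0 := by
        have : d 0 < d j.succ := hd (Fin.succ_pos j)
        simp only [hlam]; omega
      rcases Fin.eq_zero_or_eq_succ m₁ with h0 | ⟨i, hi⟩
      · subst h0
        have hBz : ∀ l, l ≠ j → B l = 0 := fun l hl => by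
          simp only [hBdef]; rw [hzero l.succ (Fin.succ_ne_zero l) (fun h => hl (Fin.succ_injective _ h)), neg_zero]
        rcases lt_or_gt_of_ne (mul_ne_zero hm₁ (neg_ne_zero.2 hm₂) : b 0 * B j ≠ 0) with hneg | hpos
        · exact (rowPsiK1_single_neg lam (b 0) B j hBz hx0 hlamj hneg hF).ne
        · exact (rowPsiK1_single_pos lam (b 0) B j hBz hx0 hlamj hpos hF).ne'
      · subst hi
        have hij : i ≠ j := fun h => (ne_of_lt hm) (by rw [h])
        have hb0 : b 0 = 0 := hzero 0 (Fin.succ_ne_zero i).symm (Fin.succ_ne_zero j).symm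
        have hBz : ∀ l, l ≠ i → l ≠ j → B l = 0 := fun l h1 h2 => by
          simp only [hBdef]
          rw [hzero l.succ (fun h => h1 (Fin.succ_injective _ h)) (fun h => h2 (Fin.succ_injective _ h)), neg_zero]
        have hrate : lam i ≠ lam j := by
          intro h
          have : d i.succ = d j.succ := by have := hd0 i.succ; have := hd0 j.succ; simp only [hlam] at h; omega
          exact hij (Fin.succ_injective _ (hd.injective this))
        have hF0 : (0 : ℝ) - ∑ l, B l * x ^ (lam l) ≠ 0 := by rwa [hb0] at hF
        rw [hb0]
        rcases lt_or_gt_of_ne (mul_ne_zero (neg_ne_zero.2 hm₁) (neg_ne_zero.2 hm₂) : B i * B j ≠ 0) with hneg | hpos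
        · exact (rowPsiK1_pair_pos lam B i j hij hBz hx0 hrate hneg hF0).ne'
        · exact (rowPsiK1_pair_neg lam B i j hij hBz hx0 hrate hpos hF0).ne
    rcases lt_or_gt_of_ne h12 with h | h
    · exact main l₁ l₂ h hl₁ hl₂ hthird
    · exact main l₂ l₁ h hl₂ hl₁ fun l h2 h1 => hthird l h1 h2

/-- ★ **THE TWO-CLUSTER ROW LAW (either sign pattern), and the cloud**: a menu row has, on `(u,v)`, a non-vanishing stripped form and `p²ψ₁ < ψ₃`.
[this file's theorem] -/
theorem twoClusterRow_law {n : ℕ} (d : Fin (n + 2) → ℕ) (hd : StrictMono d) (b : Fin (n + 2) → ℝ) {u v : ℝ} (hu : 0 < u) (p : ℕ)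
    (hrowj :
      (∃ k : Fin (n + 2),
        (((∀ l, l ≤ k → 0 ≤ b l) ∧ (∀ l, k < l → b l ≤ 0)) ∨ ((∀ l, l ≤ k → b l ≤ 0) ∧ (∀ l, k < l → 0 ≤ b l))) ∧
        (∃ l l', l ≠ l' ∧ b l ≠ 0 ∧ b l' ≠ 0) ∧
        (∀ l l', b l ≠ 0 → b l' ≠ 0 → (l' ≤ k ∨ k < l) → d l' ≤ d l + p) ∧
        (∀ l l', b l ≠ 0 → b l' ≠ 0 → l ≤ k → k < l' → d l + p ≤ d l') ∧
        (∀ x ∈ Ioo u v, (∑ l, C (b l) * X ^ (d l) : ℝ[X]).eval x ≠ 0)) ∨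
      ((∀ l : Fin (n + 1), b 0 * b l.succ ≤ 0) ∧ (∃ l : Fin (n + 1), b l.succ ≠ 0) ∧ (∀ l : Fin (n + 1), b l.succ ≠ 0 → p ≤ d l.succ - d 0) ∧
          0 < b 0 * (∑ l, C (b l) * X ^ (d l) : ℝ[X]).eval v))
    {x : ℝ} (hx : x ∈ Ioo u v) :
    b 0 - ∑ l : Fin (n + 1), (-(b l.succ)) * x ^ (d l.succ - d 0) ≠ 0 ∧
    (p : ℝ) ^ 2 * rowPsiK1 (fun l : Fin (n + 1) => d l.succ - d 0) (b 0) (fun l : Fin (n + 1) => -(b l.succ)) x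
      < rowPsiK3 (fun l : Fin (n + 1) => d l.succ - d 0) (b 0) (fun l : Fin (n + 1) => -(b l.succ)) x := by
  have hx0 : 0 < x := hu.trans hx.1
  rcases hrowj with ⟨k, hsign, hact, hwidth, hsep, hnz⟩ | hcloud
  · rcases hsign with ⟨hlow, hhigh⟩ | ⟨hlow, hhigh⟩
    · exact rowLawsAt_twoCluster_pos d hd b p k hlow hhigh hact hwidth hsep hx0 (hnz x hx)
    · -- flip the row
      have hlow' : ∀ l, l ≤ k → 0 ≤ (fun l => -b l) l := fun l hl => by simp only; linarith [hlow l hl]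
      have hhigh' : ∀ l, k < l → (fun l => -b l) l ≤ 0 := fun l hl => by simp only; linarith [hhigh l hl]
      have hact' : ∃ l l', l ≠ l' ∧ (fun l => -b l) l ≠ 0 ∧ (fun l => -b l) l' ≠ 0 := by
        obtain ⟨l, l', hll', hl, hl'⟩ := hact; exact ⟨l, l', hll', neg_ne_zero.2 hl, neg_ne_zero.2 hl'⟩
      have hwidth' : ∀ l l', (fun l => -b l) l ≠ 0 → (fun l => -b l) l' ≠ 0 → (l' ≤ k ∨ k < l) → d l' ≤ d l + p :=
        fun l l' hl hl' h => hwidth l l' (neg_ne_zero.1 hl) (neg_ne_zero.1 hl') h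
      have hsep' : ∀ l l', (fun l => -b l) l ≠ 0 → (fun l => -b l) l' ≠ 0 → l ≤ k → k < l' → d l + p ≤ d l' :=
        fun l l' hl hl' h1 h2 => hsep l l' (neg_ne_zero.1 hl) (neg_ne_zero.1 hl') h1 h2
      have hfx' : (∑ l, C ((fun l => -b l) l) * X ^ (d l) : ℝ[X]).eval x ≠ 0 := by
        simp only
        rw [eval_rowK_neg d b x]; exact neg_ne_zero.2 (hnz x hx)
      exact (rowLawAt_neg_iff d b (p : ℝ) x).1 (rowLawsAt_twoCluster_pos d hd (fun l => -b l) p k hlow' hhigh' hact' hwidth' hsep' hx0 hfx')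
  · exact rateWindowRow_law d hd b hu p (Or.inr (Or.inr (Or.inr hcloud))) hx

/-- ★★ **THE TWO-CLUSTER CELL FOR EVERY K**: `W(∏_j f_j)` has AT MOST TWO roots in `(u,v)`. [this file's theorem] -/
theorem twoClusterCellEveryK_wronskian_roots_le_two {m n : ℕ} (d : Fin (n + 2) → ℕ) (hd : StrictMono d)
    (a : Fin m → Fin (n + 2) → ℝ) {u v : ℝ} (hu : 0 < u) (p : ℕ) (hp : 0 < p)
    (hrow : ∀ j,
      (∃ k : Fin (n + 2),
        (((∀ l, l ≤ k → 0 ≤ a j l) ∧ (∀ l, k < l → a j l ≤ 0)) ∨ ((∀ l, l ≤ k → a j l ≤ 0) ∧ (∀ l, k < l → 0 ≤ a j l))) ∧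
        (∃ l l', l ≠ l' ∧ a j l ≠ 0 ∧ a j l' ≠ 0) ∧
        (∀ l l', a j l ≠ 0 → a j l' ≠ 0 → (l' ≤ k ∨ k < l) → d l' ≤ d l + p) ∧
        (∀ l l', a j l ≠ 0 → a j l' ≠ 0 → l ≤ k → k < l' → d l + p ≤ d l') ∧
        (∀ x ∈ Ioo u v, (∑ l, C (a j l) * X ^ (d l) : ℝ[X]).eval x ≠ 0)) ∨
      ((∀ l : Fin (n + 1), a j 0 * a j l.succ ≤ 0) ∧ (∃ l : Fin (n + 1), a j l.succ ≠ 0) ∧ (∀ l : Fin (n + 1), a j l.succ ≠ 0 → p ≤ d l.succ - d 0) ∧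
          0 < a j 0 * (∑ l, C (a j l) * X ^ (d l) : ℝ[X]).eval v)) :
    (((∏ j, ∑ l, C (a j l) * X ^ (d l) : ℝ[X]) * (X * derivative (X * derivative (∏ j, ∑ l, C (a j l) * X ^ (d l) : ℝ[X])))
        - (X * derivative (∏ j, ∑ l, C (a j l) * X ^ (d l) : ℝ[X])) ^ 2).roots.toFinset.filter (fun t => u < t ∧ t < v)).card ≤ 2 :=
  wronskianK_roots_le_two_of_rowLawsAt d hd a hu p hp fun j _ hx => twoClusterRow_law d hd (a j) hu p (hrow j) hx

/-- No menu row vanishes on the window. [this file's lemma] -/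
theorem twoClusterCellEveryK_eval_ne_zero {m n : ℕ} (d : Fin (n + 2) → ℕ) (hd : StrictMono d)
    (a : Fin m → Fin (n + 2) → ℝ) {u v : ℝ} (hu : 0 < u) (p : ℕ)
    (hrow : ∀ j,
      (∃ k : Fin (n + 2),
        (((∀ l, l ≤ k → 0 ≤ a j l) ∧ (∀ l, k < l → a j l ≤ 0)) ∨ ((∀ l, l ≤ k → a j l ≤ 0) ∧ (∀ l, k < l → 0 ≤ a j l))) ∧
        (∃ l l', l ≠ l' ∧ a j l ≠ 0 ∧ a j l' ≠ 0) ∧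
        (∀ l l', a j l ≠ 0 → a j l' ≠ 0 → (l' ≤ k ∨ k < l) → d l' ≤ d l + p) ∧
        (∀ l l', a j l ≠ 0 → a j l' ≠ 0 → l ≤ k → k < l' → d l + p ≤ d l') ∧
        (∀ x ∈ Ioo u v, (∑ l, C (a j l) * X ^ (d l) : ℝ[X]).eval x ≠ 0)) ∨
      ((∀ l : Fin (n + 1), a j 0 * a j l.succ ≤ 0) ∧ (∃ l : Fin (n + 1), a j l.succ ≠ 0) ∧ (∀ l : Fin (n + 1), a j l.succ ≠ 0 → p ≤ d l.succ - d 0) ∧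
          0 < a j 0 * (∑ l, C (a j l) * X ^ (d l) : ℝ[X]).eval v))
    {x : ℝ} (hx : x ∈ Ioo u v) (j : Fin m) : (∑ l, C (a j l) * X ^ (d l) : ℝ[X]).eval x ≠ 0 := by
  have hd0 : ∀ l, d 0 ≤ d l := fun l => hd.monotone (Fin.zero_le l)
  have hx0 : 0 < x := hu.trans hx.1
  rw [eval_rowK_eq d hd0 (a j) x]
  exact mul_ne_zero (pow_ne_zero _ hx0.ne') (twoClusterRow_law d hd (a j) hu p (hrow j) hx).1

/-- ★★ **THE TWO-CLUSTER CELL IN THE FLOOR'S CURRENCY**: for every coupling `l₀`, `eulerNumerator d a l₀` (unfolded) has AT MOST THREE zeros in `(u,v)`.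
[this file's theorem] -/
theorem twoClusterCellEveryK_eulerNumerator_roots_le_three {m n : ℕ} (d : Fin (n + 2) → ℕ) (hd : StrictMono d)
    (a : Fin m → Fin (n + 2) → ℝ) (l₀ : Fin (n + 2)) {u v : ℝ} (hu : 0 < u) (p : ℕ) (hp : 0 < p)
    (hrow : ∀ j,
      (∃ k : Fin (n + 2),
        (((∀ l, l ≤ k → 0 ≤ a j l) ∧ (∀ l, k < l → a j l ≤ 0)) ∨ ((∀ l, l ≤ k → a j l ≤ 0) ∧ (∀ l, k < l → 0 ≤ a j l))) ∧
        (∃ l l', l ≠ l' ∧ a j l ≠ 0 ∧ a j l' ≠ 0) ∧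
        (∀ l l', a j l ≠ 0 → a j l' ≠ 0 → (l' ≤ k ∨ k < l) → d l' ≤ d l + p) ∧
        (∀ l l', a j l ≠ 0 → a j l' ≠ 0 → l ≤ k → k < l' → d l + p ≤ d l') ∧
        (∀ x ∈ Ioo u v, (∑ l, C (a j l) * X ^ (d l) : ℝ[X]).eval x ≠ 0)) ∨
      ((∀ l : Fin (n + 1), a j 0 * a j l.succ ≤ 0) ∧ (∃ l : Fin (n + 1), a j l.succ ≠ 0) ∧ (∀ l : Fin (n + 1), a j l.succ ≠ 0 → p ≤ d l.succ - d 0) ∧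
          0 < a j 0 * (∑ l, C (a j l) * X ^ (d l) : ℝ[X]).eval v)) :
    ((∑ j, (∑ l, C (a j l * ((d l : ℝ) - d l₀)) * X ^ (d l)) * ∏ i ∈ Finset.univ.erase j, (∑ l, C (a i l) * X ^ (d l))
        : ℝ[X]).roots.toFinset.filter (fun t => u < t ∧ t < v)).card ≤ 3 := by
  classical
  refine roots_Ioo_card_le_of_Icc _ 3 fun u' v' hu' hv' => ?_
  rcases lt_or_ge v' u' with hvu | huv'
  · have : ((∑ j, (∑ l, C (a j l * ((d l : ℝ) - d l₀)) * X ^ (d l)) * ∏ i ∈ Finset.univ.erase j, (∑ l, C (a i l) * X ^ (d l))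
        : ℝ[X]).roots.toFinset.filter (fun t => u' ≤ t ∧ t ≤ v')) = ∅ :=
      Finset.filter_eq_empty_iff.2 fun t _ h => by linarith [h.1, h.2]
    rw [this]; simp
  have hu'0 : 0 < u' := hu.trans hu'
  have hP : ∀ t ∈ Set.Icc u' v', (∏ j, (∑ l, C (a j l) * X ^ (d l) : ℝ[X])).eval t ≠ 0 := by
    intro t ht
    rw [eval_prod]
    exact Finset.prod_ne_zero_iff.2 fun j _ =>
      twoClusterCellEveryK_eval_ne_zero d hd a hu p hrow ⟨hu'.trans_le ht.1, ht.2.trans_lt hv'⟩ j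
  have h1 := eulerNumerator_roots_Icc_le_wronskian_roots_add_one d a l₀ hu'0 hP
  have h2 := twoClusterCellEveryK_wronskian_roots_le_two d hd a hu p hp hrow
  have h3 : (((∏ j, ∑ l, C (a j l) * X ^ (d l) : ℝ[X]) * (X * derivative (X * derivative (∏ j, ∑ l, C (a j l) * X ^ (d l) : ℝ[X])))
            - (X * derivative (∏ j, ∑ l, C (a j l) * X ^ (d l) : ℝ[X])) ^ 2).roots.toFinset.filter (fun w => u' < w ∧ w < v')).card
      ≤ (((∏ j, ∑ l, C (a j l) * X ^ (d l) : ℝ[X]) * (X * derivative (X * derivative (∏ j, ∑ l, C (a j l) * X ^ (d l) : ℝ[X])))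
            - (X * derivative (∏ j, ∑ l, C (a j l) * X ^ (d l) : ℝ[X])) ^ 2).roots.toFinset.filter (fun t => u < t ∧ t < v)).card := by
    refine Finset.card_le_card fun t ht => ?_
    have ht' := Finset.mem_filter.1 ht
    exact Finset.mem_filter.2 ⟨ht'.1, hu'.trans ht'.2.1, ht'.2.2.trans hv'⟩
  omega

end ProductPlusOne

end Summit.ValiantsHypothesis.ValiantsHypothesis.Theorems.LacunarySymmetroidMatrixDescartes
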